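import Literature.InformationTheory.QuantumCodes.RandomCSSCodes
import Literature.InformationTheory.QuantumCodes.CSSMixedChannelConverse
import HarnessLib

/-!
# Random CSS codes on the ERASURE channel: every pair of sector loss rates `(y_Z, y_X)` with
# `y_Z + y_X < 1 - R` is achieved by CSS codes of rate `≥ R` (the erasure rate tradeoff is sharp;
# Bennett–DiVincenzo–Smolin's erasure capacity `1 - 2ε` attained by CSS codes)

Topic `Literature/InformationTheory/QuantumCodes` (venture QEC, LADDER-QEC rung Q5; qec-lit-2 gen 5). Theorem-only; no
definition, no named fact, no `sorry`.

**Printed statements.** Bennett–DiVincenzo–Smolin 1997, p. 3218: the quantum erasure channel has capacity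
`Q = 1 - 2ε`, "two bits of redundancy per erased qubit are necessary and sufficient … to recover the phase and
amplitude of all erased qubits with probability tending to 1" (sufficiency by random codes); Delfosse–Zémor 2013 §3
(`R ≤ 1 - 2p` for stabilizer codes on the erasure channel, the necessity, tree: `CSSRateTradeoff`). The erasure
pattern `E` of one CSS sector is uncorrectable iff some non-stabilizer logical is supported inside `E`
(`ErasureDecoding.IsCorrectableErasure`, Delfosse–Zémor); MacKay 2003 §14.1 / §13.5 supplies the averaging:
a fixed non-zero vector is annihilated by a fraction `2^{-m}` of the `m`-row parity-check matrices, so an erased set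
of `|E|` qubits supports a kernel vector of a random `H` with probability `≤ 2^{|E|} 2^{-m}`.

**What is proved here**:

* `eventProb_mono_rate` — for an UP-CLOSED event the Bernoulli probability is non-decreasing in the rate on `[0,1]`
  (coupling `Ber(y) ∪ Ber(z) = Ber(y + (1-y)z)`, tree's `sum_bernoulliWeight_mul_sum_union`); hence the
  uncorrectable-erasure probability is monotone in the loss rate (`uncorrectableProb_mono_rate`);
* the finset form of the Chernoff upper tail (`sum_bernoulliWeight_finset_card_ge_le_exp_dev`);
* `exists_parityChecks_erasure_le`: some `m`-row `H` has, for EVERY harmless set `S ∋ 0`,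
  `P_y[E uncorrectable for (ker H, S)] ≤ P[|E| > r] + 2^r · 2^{-m}`;
  `exists_kernelChecks_erasure_le`: given any `H^X`, some `G ∈ (ker H^X)^m` has
  `P_y[E uncorrectable for (ker G, rs H^X)] ≤ P[|E| > r] + 2^r · 2^{-m}`;
* **`exists_cssFamily_erasure_bothSectors`** (section `Families`, appended by qec-lit-2 gen 6; row-density
  forms `exists_cssFamily_erasure_tendsto_zero` / `exists_cssFamily_erasure_thresholds_ge` for any
  `ρ_Z > y_Z`, `ρ_X > y_X`, `ρ_Z + ρ_X ≤ 1 - R`): for `0 < y_Z`, `0 < y_X`, `0 ≤ R`, `y_Z + y_X < 1 - R` there are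
  CSS codes (`⌊ρ_Z n⌋` random `X`-checks, `⌊ρ_X n⌋` random `Z`-checks in their kernel, `ρ_Z + ρ_X = 1 - R`) with
  `k_n ≥ R n` whose `Z`-sector AND `X`-sector uncorrectable-erasure probabilities tend to `0` at every loss rate
  `≤ y_Z`, resp. `≤ y_X`; so `y_Z ≤ accuracyThreshold` (`Z`) and `y_X ≤ accuracyThreshold` (`X`) — the tree's
  ceiling `y₀^Z + y₀^X ≤ 1 - R` (`erasure_accuracyThresholds_add_le_one_sub_rate`, `CSSErasureCapacityConverse.lean`)
  is attained along the whole line.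

Not claimed: LDPC / local / census families; mixed loss-and-flip channels; numbers.

## References

* [BennettDivincenzoSmolin1997] C. H. Bennett, D. P. DiVincenzo, J. A. Smolin, PRL 78 (1997) 3217, p. 3218.
* [DelfosseZemor2013] N. Delfosse, G. Zémor, QIC 13 (2013) 793, §3.
* [MacKay2003] D. J. C. MacKay, *Information Theory, Inference, and Learning Algorithms*, CUP 2003, §13.5, §14.1.
* [DennisEtAl2002] E. Dennis, A. Kitaev, A. Landahl, J. Preskill, J. Math. Phys. 43 (2002) 4452, §4.1 (independent
  errors on different qubits).
-/

namespace Literature.InformationTheory.QuantumCodes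

open Finset Matrix Filter Topology

/-! ### Up-closed events: the Bernoulli probability is monotone in the rate -/

section Monotone

variable {V : Type*} [Fintype V] [DecidableEq V]

/-- **Rate monotonicity for up-closed events**: if `P` is closed under enlarging the pattern, then
`P_{y'}[P] ≤ P_{y}[P]` for `0 ≤ y' ≤ y ≤ 1` (sample `Ber(y)` as `Ber(y') ∪ Ber(z)`, `z = (y-y')/(1-y')`).
[cite: DennisEtAl2002, §4.1 (independent errors on different qubits); RichardsonUrbanke2008, Lemma 4.78 (composition of erasure channels)] -/
theorem eventProb_mono_rate (P : Finset V → Prop) [DecidablePred P] (hP : ∀ A B : Finset V, A ⊆ B → P A → P B)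
    {y' y : ℝ} (hy'0 : 0 ≤ y') (hy'y : y' ≤ y) (hy1 : y ≤ 1) : eventProb P y' ≤ eventProb P y := by
  rcases eq_or_lt_of_le (hy'y.trans hy1) with h1 | h1
  · -- `y' = 1 = y`
    have : y = 1 := le_antisymm hy1 (h1 ▸ hy'y)
    rw [h1, this]
  · set z : ℝ := (y - y') / (1 - y') with hz
    have hz0 : 0 ≤ z := div_nonneg (by linarith) (by linarith)
    have hz1 : z ≤ 1 := by rw [hz, div_le_one (by linarith)]; linarith
    have hyz : y' + (1 - y') * z = y := by rw [hz]; field_simp; ring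
    have hind : ∀ A B : Finset V, (if P A then (1 : ℝ) else 0) ≤ (if P (A ∪ B) then (1 : ℝ) else 0) := by
      intro A B
      by_cases hA : P A
      · rw [if_pos hA, if_pos (hP A (A ∪ B) subset_union_left hA)]
      · rw [if_neg hA]; split_ifs <;> norm_num
    have hL : eventProb P y' = ∑ A : Finset V, bernoulliWeight y' A * ((if P A then (1 : ℝ) else 0) *
        ∑ B : Finset V, bernoulliWeight z B) := by
      rw [sum_bernoulliWeight, eventProb_eq_sum_ite]
      simp
    have hR : eventProb P y = ∑ A : Finset V, bernoulliWeight y' A * ∑ B : Finset V,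
        bernoulliWeight z B * (if P (A ∪ B) then (1 : ℝ) else 0) := by
      have hu := sum_bernoulliWeight_mul_sum_union (V := V) y' z (fun C => if P C then (1 : ℝ) else 0)
      rw [hu, hyz, eventProb_eq_sum_ite]
      refine sum_congr rfl fun C _ => ?_
      split_ifs <;> simp
    rw [hL, hR]
    refine sum_le_sum fun A _ => mul_le_mul_of_nonneg_left ?_ (bernoulliWeight_nonneg hy'0 (by linarith) _)
    rw [mul_sum]
    exact sum_le_sum fun B _ => by
      rw [mul_comm]
      exact mul_le_mul_of_nonneg_left (hind A B) (bernoulliWeight_nonneg hz0 hz1 _)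

/-- **The uncorrectable-erasure probability of a sector is non-decreasing in the loss rate** on `[0, 1]`
(uncorrectability is up-closed: `IsCorrectableErasure.anti`). [cite: DelfosseZemor2013, §3 (erasure channel); DennisEtAl2002, §4.1] -/
theorem uncorrectableProb_mono_rate (N S : Set (V → ZMod 2)) {y' y : ℝ} (hy'0 : 0 ≤ y') (hy'y : y' ≤ y)
    (hy1 : y ≤ 1) : ErasureDecoder.uncorrectableProb N S y' ≤ ErasureDecoder.uncorrectableProb N S y := by
  classical
  unfold ErasureDecoder.uncorrectableProb
  exact eventProb_mono_rate _ (fun A B hAB hA hB => hA (hB.anti hAB)) hy'0 hy'y hy1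

end Monotone

/-! ### Counting: vectors supported in `E`; the finset form of the Chernoff upper tail -/

section Counting

variable {n : ℕ}

/-- Finset form of the Chernoff upper tail: for `0 < δ ≤ 2y`, `y ≤ 1` and `n(y+δ) ≤ b`,
`Σ_{E : |E| ≥ b} y^{|E|}(1-y)^{n-|E|} ≤ exp(-nδ²/(4y))`. [cite: MacKay2003, §14.1 (P^{(I)})] -/
theorem sum_bernoulliWeight_finset_card_ge_le_exp_dev {y δ : ℝ} (hy1 : y ≤ 1) (hδ0 : 0 < δ) (hδy : δ ≤ 2 * y) {b : ℕ}
    (hb : (n : ℝ) * (y + δ) ≤ b) :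
    ∑ E ∈ univ.filter (fun E : Finset (Fin n) => b ≤ E.card), bernoulliWeight y E ≤
      Real.exp (-(δ ^ 2 / (4 * y)) * n) := by
  have h := sum_bernoulliWeight_card_ge_le_exp_dev (V := Fin n) hy1 hδ0 hδy (b := b) (by rwa [Fintype.card_fin])
  rw [Fintype.card_fin] at h
  refine le_of_eq_of_le ?_ h
  refine sum_nbij' vecOf supp (fun E hE => ?_) (fun x hx => ?_) (fun E _ => supp_vecOf E) (fun x _ => vecOf_supp x)
    fun E _ => by rw [supp_vecOf]
  · rw [mem_filter] at hE ⊢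
    rw [supp_vecOf]
    exact ⟨mem_univ _, hE.2⟩
  · rw [mem_filter] at hx ⊢
    exact ⟨mem_univ _, hx.2⟩

end Counting

/-! ### First sector: random parity checks rarely have a kernel vector inside the erased set -/

section FirstSector

variable {n m : ℕ}

open Classical in
/-- **A good `X`-check matrix for erasures EXISTS** (averaging): for all `n, m, r` and weights `W ≥ 0` on erasure
patterns with `Σ W ≤ 1` there is an `m`-row `H` such that for EVERY harmless set `S ∋ 0` (later: `rs H^Z`) the
`W`-mass of the patterns `E` that support some `x ∈ ker H ∖ S` is `≤ W[|E| > r] + 2^r · 2^{-m}`.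
[cite: MacKay2003, §13.5 and §14.1 eqs. (14.13)–(14.16); BennettDivincenzoSmolin1997, p. 3218 (sufficiency)] -/
theorem exists_parityChecks_erasure_le (n m r : ℕ) {W : Finset (Fin n) → ℝ} (hW : ∀ E, 0 ≤ W E)
    (hW1 : ∑ E, W E ≤ 1) :
    ∃ H : Fin m → Fin n → ZMod 2, ∀ S : Set (Fin n → ZMod 2), (0 : Fin n → ZMod 2) ∈ S →
      ∑ E ∈ univ.filter (fun E : Finset (Fin n) =>
          ¬ IsCorrectableErasure {x : Fin n → ZMod 2 | Matrix.of H *ᵥ x = 0} S E), W E ≤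
        (∑ E ∈ univ.filter (fun E : Finset (Fin n) => r < E.card), W E) + (2 : ℝ) ^ r / (2 : ℝ) ^ m := by
  set g : (Fin m → Fin n → ZMod 2) → ℝ := fun H => ∑ E ∈ univ.filter (fun E : Finset (Fin n) => E.card ≤ r),
    W E * ∑ x ∈ univ.filter (fun x : Fin n → ZMod 2 => supp x ⊆ E ∧ x ≠ 0),
      (if Matrix.of H *ᵥ x = 0 then (1 : ℝ) else 0) with hg
  set N : ℝ := ((Fintype.card (Fin m → Fin n → ZMod 2) : ℕ) : ℝ) with hN
  -- average of `g`
  have havg : ∑ H, g H ≤ ∑ _H : Fin m → Fin n → ZMod 2, (2 : ℝ) ^ r / 2 ^ m := by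
    have hsum : ∑ H, g H = ∑ E ∈ univ.filter (fun E : Finset (Fin n) => E.card ≤ r),
        W E * ∑ x ∈ univ.filter (fun x : Fin n → ZMod 2 => supp x ⊆ E ∧ x ≠ 0),
          ∑ H : Fin m → Fin n → ZMod 2, (if Matrix.of H *ᵥ x = 0 then (1 : ℝ) else 0) := by
      rw [hg, sum_comm]
      refine sum_congr rfl fun E _ => ?_
      rw [← mul_sum, sum_comm]
    have hterm : ∀ E : Finset (Fin n), ∑ x ∈ univ.filter (fun x : Fin n → ZMod 2 => supp x ⊆ E ∧ x ≠ 0),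
        ∑ H : Fin m → Fin n → ZMod 2, (if Matrix.of H *ᵥ x = 0 then (1 : ℝ) else 0) ≤ (2 : ℝ) ^ E.card * (N / 2 ^ m) := by
      intro E
      have hcnt : ∀ x ∈ univ.filter (fun x : Fin n → ZMod 2 => supp x ⊆ E ∧ x ≠ 0),
          ∑ H : Fin m → Fin n → ZMod 2, (if Matrix.of H *ᵥ x = 0 then (1 : ℝ) else 0) = N / 2 ^ m := by
        intro x hx
        rw [mem_filter] at hx
        have h := two_pow_mul_card_filter_mulVec_eq_zero (m := m) hx.2.2
        rw [sum_boole, eq_div_iff (by positivity), hN, mul_comm]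
        exact_mod_cast h
      rw [sum_congr rfl hcnt, sum_const, nsmul_eq_mul]
      refine mul_le_mul_of_nonneg_right ?_ (by positivity)
      have hsub : (univ.filter fun x : Fin n → ZMod 2 => supp x ⊆ E ∧ x ≠ 0) ⊆
          univ.filter fun x : Fin n → ZMod 2 => supp x ⊆ E := by
        intro x hx; rw [mem_filter] at hx ⊢; exact ⟨hx.1, hx.2.1⟩
      have h := card_le_card hsub
      rw [card_filter_supp_subset] at h
      exact_mod_cast h
    rw [hsum, sum_const, card_univ, nsmul_eq_mul, ← hN]
    calc ∑ E ∈ univ.filter (fun E : Finset (Fin n) => E.card ≤ r),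
          W E * ∑ x ∈ univ.filter (fun x : Fin n → ZMod 2 => supp x ⊆ E ∧ x ≠ 0),
            ∑ H : Fin m → Fin n → ZMod 2, (if Matrix.of H *ᵥ x = 0 then (1 : ℝ) else 0)
        ≤ ∑ E ∈ univ.filter (fun E : Finset (Fin n) => E.card ≤ r), W E * ((2 : ℝ) ^ r * (N / 2 ^ m)) := by
          refine sum_le_sum fun E hE => mul_le_mul_of_nonneg_left ((hterm E).trans ?_) (hW E)
          rw [mem_filter] at hE
          exact mul_le_mul_of_nonneg_right (pow_le_pow_right₀ (by norm_num) hE.2) (by positivity)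
      _ = (∑ E ∈ univ.filter (fun E : Finset (Fin n) => E.card ≤ r), W E) * ((2 : ℝ) ^ r * (N / 2 ^ m)) := by
          rw [sum_mul]
      _ ≤ 1 * ((2 : ℝ) ^ r * (N / 2 ^ m)) := by
          refine mul_le_mul_of_nonneg_right ?_ (by positivity)
          exact (sum_le_sum_of_subset_of_nonneg (filter_subset _ _) fun E _ _ => hW E).trans hW1
      _ = N * ((2 : ℝ) ^ r / 2 ^ m) := by ring
  obtain ⟨H, _, hH⟩ := exists_le_of_sum_le univ_nonempty havg
  refine ⟨H, fun S h0 => ?_⟩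
  -- cover the uncorrectable patterns
  have hg0 : ∀ E : Finset (Fin n), 0 ≤ ∑ x ∈ univ.filter (fun x : Fin n → ZMod 2 => supp x ⊆ E ∧ x ≠ 0),
      (if Matrix.of H *ᵥ x = 0 then (1 : ℝ) else 0) := fun E => sum_nonneg fun x _ => by split_ifs <;> norm_num
  have hone : ∀ E : Finset (Fin n),
      ¬ IsCorrectableErasure {x : Fin n → ZMod 2 | Matrix.of H *ᵥ x = 0} S E →
        (1 : ℝ) ≤ ∑ x ∈ univ.filter (fun x : Fin n → ZMod 2 => supp x ⊆ E ∧ x ≠ 0),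
          (if Matrix.of H *ᵥ x = 0 then (1 : ℝ) else 0) := by
    intro E hE
    unfold IsCorrectableErasure at hE
    push Not at hE
    obtain ⟨x, hxN, hxE, hxS⟩ := hE
    have hx0 : x ≠ 0 := fun h => hxS (h ▸ h0)
    have hxN' : Matrix.of H *ᵥ x = 0 := hxN
    have h1 : (1 : ℝ) = (if Matrix.of H *ᵥ x = 0 then (1 : ℝ) else 0) := by rw [if_pos hxN']
    exact h1.trans_le (single_le_sum (s := univ.filter (fun x : Fin n → ZMod 2 => supp x ⊆ E ∧ x ≠ 0))
      (f := fun x => if Matrix.of H *ᵥ x = 0 then (1 : ℝ) else 0) (fun x _ => by split_ifs <;> norm_num)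
      (mem_filter.2 ⟨mem_univ _, hxE, hx0⟩))
  calc ∑ E ∈ univ.filter (fun E : Finset (Fin n) =>
          ¬ IsCorrectableErasure {x : Fin n → ZMod 2 | Matrix.of H *ᵥ x = 0} S E), W E
      ≤ ∑ E ∈ (univ.filter fun E : Finset (Fin n) => r < E.card) ∪
          (univ.filter fun E : Finset (Fin n) => E.card ≤ r ∧
            ¬ IsCorrectableErasure {x : Fin n → ZMod 2 | Matrix.of H *ᵥ x = 0} S E), W E := by
        refine sum_le_sum_of_subset_of_nonneg (fun E hE => ?_) fun E _ _ => hW E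
        rw [mem_filter] at hE
        rw [mem_union, mem_filter, mem_filter]
        by_cases hr : r < E.card
        · exact Or.inl ⟨mem_univ _, hr⟩
        · exact Or.inr ⟨mem_univ _, not_lt.1 hr, hE.2⟩
    _ ≤ (∑ E ∈ univ.filter (fun E : Finset (Fin n) => r < E.card), W E) +
        ∑ E ∈ univ.filter (fun E : Finset (Fin n) => E.card ≤ r ∧
          ¬ IsCorrectableErasure {x : Fin n → ZMod 2 | Matrix.of H *ᵥ x = 0} S E), W E := by
        rw [← sum_union_inter]
        linarith [sum_nonneg (s := (univ.filter fun E : Finset (Fin n) => r < E.card) ∩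
          univ.filter fun E : Finset (Fin n) => E.card ≤ r ∧
            ¬ IsCorrectableErasure {x : Fin n → ZMod 2 | Matrix.of H *ᵥ x = 0} S E)
          fun E _ => hW E]
    _ ≤ (∑ E ∈ univ.filter (fun E : Finset (Fin n) => r < E.card), W E) + g H := by
        rw [hg]
        refine add_le_add le_rfl ?_
        calc ∑ E ∈ univ.filter (fun E : Finset (Fin n) => E.card ≤ r ∧
              ¬ IsCorrectableErasure {x : Fin n → ZMod 2 | Matrix.of H *ᵥ x = 0} S E), W E
            ≤ ∑ E ∈ univ.filter (fun E : Finset (Fin n) => E.card ≤ r ∧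
                ¬ IsCorrectableErasure {x : Fin n → ZMod 2 | Matrix.of H *ᵥ x = 0} S E),
                W E * ∑ x ∈ univ.filter (fun x : Fin n → ZMod 2 => supp x ⊆ E ∧ x ≠ 0),
                  (if Matrix.of H *ᵥ x = 0 then (1 : ℝ) else 0) := by
              refine sum_le_sum fun E hE => ?_
              rw [mem_filter] at hE
              have h := mul_le_mul_of_nonneg_left (hone E hE.2.2) (hW E)
              rwa [mul_one] at h
          _ ≤ _ := sum_le_sum_of_subset_of_nonneg (fun E hE => by
                rw [mem_filter] at hE ⊢; exact ⟨hE.1, hE.2.1⟩) fun E _ _ => mul_nonneg (hW E) (hg0 E)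
    _ ≤ _ := add_le_add le_rfl hH

end FirstSector

/-! ### Second sector: `Z`-checks inside `ker H^X`, harmless set `rs H^X` -/

section SecondSector

variable {n m₁ m : ℕ}

open Classical in
/-- **Good commuting `Z`-checks for erasures EXIST** (averaging over `(ker H^X)^m`): for every `H^X` and weights
`W ≥ 0` with `Σ W ≤ 1` there is `G ∈ (ker H^X)^m` such that the `W`-mass of the erasure patterns supporting some
`x` with `Gx = 0`, `x ∉ rs H^X` is `≤ W[|E| > r] + 2^r · 2^{-m}`.
[cite: MacKay2003, §14.1 eqs. (14.13)–(14.16); BennettDivincenzoSmolin1997, p. 3218] -/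
theorem exists_kernelChecks_erasure_le (HX : Fin m₁ → Fin n → ZMod 2) (m r : ℕ) {W : Finset (Fin n) → ℝ}
    (hW : ∀ E, 0 ≤ W E) (hW1 : ∑ E, W E ≤ 1) :
    ∃ G : Fin m → Fin n → ZMod 2, (∀ i, Matrix.of HX *ᵥ G i = 0) ∧
      ∑ E ∈ univ.filter (fun E : Finset (Fin n) =>
          ¬ IsCorrectableErasure {x : Fin n → ZMod 2 | Matrix.of G *ᵥ x = 0}
            (rowSpace (Matrix.of HX) : Set (Fin n → ZMod 2)) E), W E ≤
        (∑ E ∈ univ.filter (fun E : Finset (Fin n) => r < E.card), W E) + (2 : ℝ) ^ r / (2 : ℝ) ^ m := by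
  set K := univ.filter fun u : Fin n → ZMod 2 => Matrix.of HX *ᵥ u = 0 with hK
  set U := Fintype.piFinset fun _ : Fin m => K with hU
  set ind : (Fin m → Fin n → ZMod 2) → (Fin n → ZMod 2) → ℝ := fun G x =>
    if Matrix.of G *ᵥ x = Matrix.of G *ᵥ 0 ∧ x - 0 ∉ rowSpace (Matrix.of HX) then (1 : ℝ) else 0 with hind
  set g : (Fin m → Fin n → ZMod 2) → ℝ := fun G => ∑ E ∈ univ.filter (fun E : Finset (Fin n) => E.card ≤ r),
    W E * ∑ x ∈ univ.filter (fun x : Fin n → ZMod 2 => supp x ⊆ E), ind G x with hg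
  have hUne : U.Nonempty :=
    ⟨fun _ => 0, Fintype.mem_piFinset.2 fun _ => mem_filter.2 ⟨mem_univ _, Matrix.mulVec_zero _⟩⟩
  have hind0 : ∀ G x, 0 ≤ ind G x := fun G x => by rw [hind]; dsimp only; split_ifs <;> norm_num
  have havg : ∑ G ∈ U, g G ≤ ∑ _G ∈ U, (2 : ℝ) ^ r / 2 ^ m := by
    have hsum : ∑ G ∈ U, g G = ∑ E ∈ univ.filter (fun E : Finset (Fin n) => E.card ≤ r),
        W E * ∑ x ∈ univ.filter (fun x : Fin n → ZMod 2 => supp x ⊆ E), ∑ G ∈ U, ind G x := by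
      rw [hg, sum_comm]
      refine sum_congr rfl fun E _ => ?_
      rw [← mul_sum, sum_comm]
    have hterm : ∀ E : Finset (Fin n), ∑ x ∈ univ.filter (fun x : Fin n → ZMod 2 => supp x ⊆ E), ∑ G ∈ U, ind G x ≤
        (2 : ℝ) ^ E.card * ((U.card : ℝ) / 2 ^ m) := by
      intro E
      have hx : ∀ x : Fin n → ZMod 2, ∑ G ∈ U, ind G x ≤ (U.card : ℝ) / 2 ^ m := fun x =>
        sum_ite_kernelChecks_le HX x 0
      calc ∑ x ∈ univ.filter (fun x : Fin n → ZMod 2 => supp x ⊆ E), ∑ G ∈ U, ind G x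
          ≤ ∑ _x ∈ univ.filter (fun x : Fin n → ZMod 2 => supp x ⊆ E), (U.card : ℝ) / 2 ^ m :=
            sum_le_sum fun x _ => hx x
        _ = (2 : ℝ) ^ E.card * ((U.card : ℝ) / 2 ^ m) := by
            rw [sum_const, card_filter_supp_subset, nsmul_eq_mul]
            push_cast
            ring
    rw [hsum, sum_const, nsmul_eq_mul]
    calc ∑ E ∈ univ.filter (fun E : Finset (Fin n) => E.card ≤ r),
          W E * ∑ x ∈ univ.filter (fun x : Fin n → ZMod 2 => supp x ⊆ E), ∑ G ∈ U, ind G x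
        ≤ ∑ E ∈ univ.filter (fun E : Finset (Fin n) => E.card ≤ r), W E * ((2 : ℝ) ^ r * ((U.card : ℝ) / 2 ^ m)) := by
          refine sum_le_sum fun E hE => mul_le_mul_of_nonneg_left ((hterm E).trans ?_) (hW E)
          rw [mem_filter] at hE
          exact mul_le_mul_of_nonneg_right (pow_le_pow_right₀ (by norm_num) hE.2) (by positivity)
      _ = (∑ E ∈ univ.filter (fun E : Finset (Fin n) => E.card ≤ r), W E) * ((2 : ℝ) ^ r * ((U.card : ℝ) / 2 ^ m)) := by
          rw [sum_mul]
      _ ≤ 1 * ((2 : ℝ) ^ r * ((U.card : ℝ) / 2 ^ m)) := by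
          refine mul_le_mul_of_nonneg_right ?_ (by positivity)
          exact (sum_le_sum_of_subset_of_nonneg (filter_subset _ _) fun E _ _ => hW E).trans hW1
      _ = U.card * ((2 : ℝ) ^ r / 2 ^ m) := by ring
  obtain ⟨G, hGU, hGle⟩ := exists_le_of_sum_le hUne havg
  have hGK : ∀ i, Matrix.of HX *ᵥ G i = 0 := fun i => by
    have h := Fintype.mem_piFinset.1 hGU i
    rw [hK, mem_filter] at h
    exact h.2
  refine ⟨G, hGK, ?_⟩
  have hone : ∀ E : Finset (Fin n),
      ¬ IsCorrectableErasure {x : Fin n → ZMod 2 | Matrix.of G *ᵥ x = 0}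
          (rowSpace (Matrix.of HX) : Set (Fin n → ZMod 2)) E →
        (1 : ℝ) ≤ ∑ x ∈ univ.filter (fun x : Fin n → ZMod 2 => supp x ⊆ E), ind G x := by
    intro E hE
    unfold IsCorrectableErasure at hE
    push Not at hE
    obtain ⟨x, hxN, hxE, hxS⟩ := hE
    have hx1 : ind G x = 1 := by
      rw [hind]
      dsimp only
      rw [if_pos]
      have hxN' : Matrix.of G *ᵥ x = 0 := hxN
      refine ⟨by rw [Matrix.mulVec_zero]; exact hxN', by rw [sub_zero]; exact hxS⟩
    rw [← hx1]
    exact single_le_sum (s := univ.filter (fun x : Fin n → ZMod 2 => supp x ⊆ E)) (f := ind G)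
      (fun x _ => hind0 G x) (mem_filter.2 ⟨mem_univ _, hxE⟩)
  calc ∑ E ∈ univ.filter (fun E : Finset (Fin n) =>
          ¬ IsCorrectableErasure {x : Fin n → ZMod 2 | Matrix.of G *ᵥ x = 0}
            (rowSpace (Matrix.of HX) : Set (Fin n → ZMod 2)) E), W E
      ≤ ∑ E ∈ (univ.filter fun E : Finset (Fin n) => r < E.card) ∪
          (univ.filter fun E : Finset (Fin n) => E.card ≤ r ∧
            ¬ IsCorrectableErasure {x : Fin n → ZMod 2 | Matrix.of G *ᵥ x = 0}
              (rowSpace (Matrix.of HX) : Set (Fin n → ZMod 2)) E), W E := by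
        refine sum_le_sum_of_subset_of_nonneg (fun E hE => ?_) fun E _ _ => hW E
        rw [mem_filter] at hE
        rw [mem_union, mem_filter, mem_filter]
        by_cases hr : r < E.card
        · exact Or.inl ⟨mem_univ _, hr⟩
        · exact Or.inr ⟨mem_univ _, not_lt.1 hr, hE.2⟩
    _ ≤ (∑ E ∈ univ.filter (fun E : Finset (Fin n) => r < E.card), W E) +
        ∑ E ∈ univ.filter (fun E : Finset (Fin n) => E.card ≤ r ∧
          ¬ IsCorrectableErasure {x : Fin n → ZMod 2 | Matrix.of G *ᵥ x = 0}
            (rowSpace (Matrix.of HX) : Set (Fin n → ZMod 2)) E), W E := by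
        rw [← sum_union_inter]
        linarith [sum_nonneg (s := (univ.filter fun E : Finset (Fin n) => r < E.card) ∩
          univ.filter fun E : Finset (Fin n) => E.card ≤ r ∧
            ¬ IsCorrectableErasure {x : Fin n → ZMod 2 | Matrix.of G *ᵥ x = 0}
              (rowSpace (Matrix.of HX) : Set (Fin n → ZMod 2)) E) fun E _ => hW E]
    _ ≤ (∑ E ∈ univ.filter (fun E : Finset (Fin n) => r < E.card), W E) + g G := by
        rw [hg]
        refine add_le_add le_rfl ?_
        calc ∑ E ∈ univ.filter (fun E : Finset (Fin n) => E.card ≤ r ∧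
              ¬ IsCorrectableErasure {x : Fin n → ZMod 2 | Matrix.of G *ᵥ x = 0}
                (rowSpace (Matrix.of HX) : Set (Fin n → ZMod 2)) E), W E
            ≤ ∑ E ∈ univ.filter (fun E : Finset (Fin n) => E.card ≤ r ∧
                ¬ IsCorrectableErasure {x : Fin n → ZMod 2 | Matrix.of G *ᵥ x = 0}
                  (rowSpace (Matrix.of HX) : Set (Fin n → ZMod 2)) E),
                W E * ∑ x ∈ univ.filter (fun x : Fin n → ZMod 2 => supp x ⊆ E), ind G x := by
              refine sum_le_sum fun E hE => ?_
              rw [mem_filter] at hE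
              have h := mul_le_mul_of_nonneg_left (hone E hE.2.2) (hW E)
              rwa [mul_one] at h
          _ ≤ _ := sum_le_sum_of_subset_of_nonneg (fun E hE => by
                rw [mem_filter] at hE ⊢; exact ⟨hE.1, hE.2.1⟩)
                fun E _ _ => mul_nonneg (hW E) (sum_nonneg fun x _ => hind0 G x)
    _ ≤ _ := add_le_add le_rfl hGle

end SecondSector

/-! ### Families: every pair `(y_Z, y_X)` with `y_Z + y_X < 1 - R` is achieved (appended 2026-08-27, qec-lit-2 gen 6)

For row densities `ρ_Z > y_Z`, `ρ_X > y_X` with `ρ_Z + ρ_X ≤ 1 - R`: the CSS codes on `n` qubits with `⌊ρ_Z n⌋`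
averaged `X`-checks (`exists_parityChecks_erasure_le`, weights `Ber(y_Z)`, radius `r = ⌊(y_Z + δ) n⌋`) and
`⌊ρ_X n⌋` averaged `Z`-checks inside their kernel (`exists_kernelChecks_erasure_le`) have
`k ≥ n - ⌊ρ_Z n⌋ - ⌊ρ_X n⌋ ≥ R n`, and each sector's uncorrectable-erasure probability is
`≤ e^{-nδ²/(4y)} + 2 · 2^{-(ρ - y - δ) n} → 0` (`δ = min(y, (ρ - y)/2)`); monotonicity in the loss rate
(`uncorrectableProb_mono_rate`) turns the limits into threshold lower bounds `y_Z`, `y_X`. With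
`ρ_Z = y_Z + gap/2`, `ρ_X = y_X + gap/2`, `gap = 1 - R - y_Z - y_X > 0` this is Bennett–DiVincenzo–Smolin's
sufficiency «two bits of redundancy per erased qubit … sufficient» [p. 3218, footnote cf2: «identical to random
linear stabilizer codes»] in its sector-wise CSS form: the tree's ceiling `y₀^Z + y₀^X ≤ 1 - R`
(`erasure_accuracyThresholds_add_le_one_sub_rate`, families with `k ≥ 1`) is attained along the whole line. -/

section Families

/-- `exp(-a n) → 0` (`a > 0`). [folklore] -/
private theorem tendsto_exp_neg_mul_nat_erasure {a : ℝ} (ha : 0 < a) :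
    Tendsto (fun n : ℕ => Real.exp (-a * n)) atTop (𝓝 0) := by
  have h : Tendsto (fun n : ℕ => Real.exp (-a) ^ n) atTop (𝓝 0) :=
    tendsto_pow_atTop_nhds_zero_of_lt_one (Real.exp_pos _).le (Real.exp_lt_one_iff.2 (by linarith))
  refine h.congr fun n => ?_
  rw [← Real.exp_nat_mul, mul_comm]

variable {n m₁ m₂ : ℕ}

/-- `Z`-checks taken inside `ker H^X` commute with the `X`-checks, `H^X (H^Z)ᵀ = 0`, for any numbers `m₁`, `m₂`
of rows. [cite: DennisEtAl2002, §4.1 (CSS codes: each X-type generator commutes with each Z-type generator)] -/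
theorem of_mul_transpose_of_forall_mulVec_eq_zero (HX : Fin m₁ → Fin n → ZMod 2) (G : Fin m₂ → Fin n → ZMod 2)
    (hG : ∀ i, Matrix.of HX *ᵥ G i = 0) : Matrix.of HX * (Matrix.of G)ᵀ = 0 := by
  ext i j
  have h := congrFun (hG j) i
  simpa [Matrix.mul_apply, Matrix.mulVec, dotProduct] using h

/-- `k ≥ n - m₁ - m₂` for a CSS code with `m₁` `X`-checks and `m₂` `Z`-checks (`k = n - rk H^X - rk H^Z`).
[cite: DennisEtAl2002, §4.6 (R ≡ k/n); MacKay2003, §14.1 eq. (14.1)] -/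
theorem CSSCode.k_ge_of_heights (C : CSSCode (Fin m₁) (Fin m₂) (Fin n)) : (n : ℝ) - m₁ - m₂ ≤ (C.k : ℝ) := by
  have hk := C.k_eq
  have h1 : C.HX.rank ≤ m₁ := Matrix.rank_le_height _
  have h2 : C.HZ.rank ≤ m₂ := Matrix.rank_le_height _
  rw [Fintype.card_fin] at hk
  have hk' : n ≤ C.k + m₁ + m₂ := by omega
  have : (n : ℝ) ≤ (C.k : ℝ) + m₁ + m₂ := by exact_mod_cast hk'
  linarith

/-- `2^{⌊(y+δ)n⌋} / 2^{⌊ρn⌋} ≤ 2 · e^{-(ρ-y-δ)(log 2) n}`. [folklore] -/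
private theorem two_pow_floor_div_le {y δ ρ : ℝ} (hyδ : 0 ≤ y + δ) (n : ℕ) :
    (2 : ℝ) ^ ⌊(y + δ) * (n : ℝ)⌋₊ / (2 : ℝ) ^ ⌊ρ * (n : ℝ)⌋₊ ≤
      2 * Real.exp (-((ρ - y - δ) * Real.log 2) * n) := by
  have hlog2 : 0 < Real.log 2 := Real.log_pos (by norm_num)
  have hr : (⌊(y + δ) * (n : ℝ)⌋₊ : ℝ) ≤ (y + δ) * n := Nat.floor_le (mul_nonneg hyδ (Nat.cast_nonneg _))
  have hm : ρ * n - 1 ≤ (⌊ρ * (n : ℝ)⌋₊ : ℝ) := by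
    have := Nat.lt_floor_add_one (ρ * (n : ℝ))
    linarith
  rw [show (2 : ℝ) ^ ⌊(y + δ) * (n : ℝ)⌋₊ = Real.exp (⌊(y + δ) * (n : ℝ)⌋₊ * Real.log 2) by
      rw [Real.exp_nat_mul, Real.exp_log (by norm_num : (0 : ℝ) < 2)],
    show (2 : ℝ) ^ ⌊ρ * (n : ℝ)⌋₊ = Real.exp (⌊ρ * (n : ℝ)⌋₊ * Real.log 2) by
      rw [Real.exp_nat_mul, Real.exp_log (by norm_num : (0 : ℝ) < 2)],
    ← Real.exp_sub,
    show (2 : ℝ) * Real.exp (-((ρ - y - δ) * Real.log 2) * n) =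
        Real.exp (Real.log 2 + -((ρ - y - δ) * Real.log 2) * n) by
      rw [Real.exp_add, Real.exp_log (by norm_num : (0 : ℝ) < 2)],
    Real.exp_le_exp]
  have h1 := mul_le_mul_of_nonneg_right hr hlog2.le
  have h2 := mul_le_mul_of_nonneg_right hm hlog2.le
  linarith

/-- The finite-size estimate shared by both sectors: for `0 ≤ y ≤ 1`, `0 < δ ≤ 2y`,
`P_y[|E| > ⌊(y+δ)n⌋] + 2^{⌊(y+δ)n⌋}/2^{⌊ρn⌋} ≤ e^{-nδ²/(4y)} + 2 e^{-(ρ-y-δ)(log 2) n}`.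
[cite: MacKay2003, §14.1 (P^{(I)} and P^{(II)} both vanish as N increases)] -/
private theorem erasure_finiteSize_le {y δ ρ : ℝ} (hy0 : 0 ≤ y) (hy1 : y ≤ 1) (hδ0 : 0 < δ) (hδy : δ ≤ 2 * y)
    (n : ℕ) :
    (∑ E ∈ univ.filter (fun E : Finset (Fin n) => ⌊(y + δ) * (n : ℝ)⌋₊ < E.card), bernoulliWeight y E) +
        (2 : ℝ) ^ ⌊(y + δ) * (n : ℝ)⌋₊ / (2 : ℝ) ^ ⌊ρ * (n : ℝ)⌋₊ ≤
      Real.exp (-(δ ^ 2 / (4 * y)) * n) + 2 * Real.exp (-((ρ - y - δ) * Real.log 2) * n) := by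
  have hT1 : ∑ E ∈ univ.filter (fun E : Finset (Fin n) => ⌊(y + δ) * (n : ℝ)⌋₊ < E.card), bernoulliWeight y E ≤
      Real.exp (-(δ ^ 2 / (4 * y)) * n) := by
    have hb : (n : ℝ) * (y + δ) ≤ ((⌊(y + δ) * (n : ℝ)⌋₊ + 1 : ℕ) : ℝ) := by
      push_cast
      rw [mul_comm]
      exact (Nat.lt_floor_add_one _).le
    have h := sum_bernoulliWeight_finset_card_ge_le_exp_dev (n := n) hy1 hδ0 hδy hb
    refine le_trans (sum_le_sum_of_subset_of_nonneg (fun E hE => ?_) fun E _ _ => bernoulliWeight_nonneg hy0 hy1 E) h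
    rw [mem_filter] at hE ⊢
    exact ⟨mem_univ _, hE.2⟩
  have hT2 := two_pow_floor_div_le (ρ := ρ) (by linarith : 0 ≤ y + δ) n
  linarith

/-- **GOOD CSS CODES FOR ERASURES EXIST at every pair of sector loss rates below the row densities**: for
`0 < y_Z < ρ_Z`, `0 < y_X < ρ_X`, `0 ≤ R`, `ρ_Z + ρ_X ≤ 1 - R` there are CSS codes `C_n` on `n = 0, 1, 2, …` qubits
with `⌊ρ_Z n⌋` `X`-checks and `⌊ρ_X n⌋` `Z`-checks, `H^X_n (H^Z_n)ᵀ = 0`, `k_n ≥ R n`, whose `Z`-sector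
uncorrectable-erasure probability at loss rate `y_Z` (an erased set `E ~ Ber(y_Z)` supports a `Z`-logical:
some `x ∈ ker H^X_n ∖ rs H^Z_n` with `supp x ⊆ E`) AND `X`-sector uncorrectable-erasure probability at loss rate
`y_X` both tend to `0`. [cite: BennettDivincenzoSmolin1997, p. 3218 (two bits of redundancy per erased qubit are
sufficient; footnote cf2: random linear stabilizer codes); MacKay2003, §14.1 eqs. (14.13)–(14.17)] -/
theorem exists_cssFamily_erasure_tendsto_zero {yZ yX ρZ ρX R : ℝ} (hyZ : 0 < yZ) (hZ : yZ < ρZ) (hyX : 0 < yX)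
    (hX : yX < ρX) (hR0 : 0 ≤ R) (hρ : ρZ + ρX ≤ 1 - R) :
    ∃ (HX : ∀ n : ℕ, Fin ⌊ρZ * n⌋₊ → Fin n → ZMod 2) (HZ : ∀ n : ℕ, Fin ⌊ρX * n⌋₊ → Fin n → ZMod 2)
      (hc : ∀ n, Matrix.of (HX n) * (Matrix.of (HZ n))ᵀ = 0),
      (∀ n : ℕ, R * (n : ℝ) ≤ ((CSSCode.ofMatrices (Matrix.of (HX n)) (Matrix.of (HZ n)) (hc n)).k : ℝ)) ∧
      Tendsto (fun n => ErasureDecoder.uncorrectableProb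
        {x : Fin n → ZMod 2 | (CSSCode.ofMatrices (Matrix.of (HX n)) (Matrix.of (HZ n)) (hc n)).HX *ᵥ x = 0}
        ((CSSCode.ofMatrices (Matrix.of (HX n)) (Matrix.of (HZ n)) (hc n)).rowSpZ : Set (Fin n → ZMod 2)) yZ)
        atTop (𝓝 0) ∧
      Tendsto (fun n => ErasureDecoder.uncorrectableProb
        {x : Fin n → ZMod 2 | (CSSCode.ofMatrices (Matrix.of (HX n)) (Matrix.of (HZ n)) (hc n)).HZ *ᵥ x = 0}
        ((CSSCode.ofMatrices (Matrix.of (HX n)) (Matrix.of (HZ n)) (hc n)).rowSpX : Set (Fin n → ZMod 2)) yX)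
        atTop (𝓝 0) := by
  classical
  have hyZ1 : yZ ≤ 1 := by linarith
  have hyX1 : yX ≤ 1 := by linarith
  -- margins `δ = min(y, (ρ - y)/2)`
  set δZ : ℝ := min yZ ((ρZ - yZ) / 2) with hδZ_def
  set δX : ℝ := min yX ((ρX - yX) / 2) with hδX_def
  have hδZ0 : 0 < δZ := lt_min hyZ (by linarith)
  have hδX0 : 0 < δX := lt_min hyX (by linarith)
  have hδZy : δZ ≤ 2 * yZ := (min_le_left _ _).trans (by linarith)
  have hδXy : δX ≤ 2 * yX := (min_le_left _ _).trans (by linarith)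
  have hgZ : 0 < ρZ - yZ - δZ := by
    have := min_le_right yZ ((ρZ - yZ) / 2)
    linarith
  have hgX : 0 < ρX - yX - δX := by
    have := min_le_right yX ((ρX - yX) / 2)
    linarith
  -- weights
  have hwZ : ∀ n (E : Finset (Fin n)), 0 ≤ bernoulliWeight yZ E := fun n E => bernoulliWeight_nonneg hyZ.le hyZ1 E
  have hwX : ∀ n (E : Finset (Fin n)), 0 ≤ bernoulliWeight yX E := fun n E => bernoulliWeight_nonneg hyX.le hyX1 E
  have hw1 : ∀ (y : ℝ) n, ∑ E : Finset (Fin n), bernoulliWeight y E ≤ 1 := fun y n => (sum_bernoulliWeight y).le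
  -- the `X`-checks (first sector), then the `Z`-checks inside their kernel (second sector)
  choose HX hHX using fun n : ℕ =>
    exists_parityChecks_erasure_le n ⌊ρZ * (n : ℝ)⌋₊ ⌊(yZ + δZ) * (n : ℝ)⌋₊ (hwZ n) (hw1 yZ n)
  choose G hGK hG using fun n : ℕ =>
    exists_kernelChecks_erasure_le (HX n) ⌊ρX * (n : ℝ)⌋₊ ⌊(yX + δX) * (n : ℝ)⌋₊ (hwX n) (hw1 yX n)
  have hc : ∀ n, Matrix.of (HX n) * (Matrix.of (G n))ᵀ = 0 := fun n =>
    of_mul_transpose_of_forall_mulVec_eq_zero _ _ (hGK n)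
  have hlimZ : Tendsto (fun n : ℕ => Real.exp (-(δZ ^ 2 / (4 * yZ)) * n) +
      2 * Real.exp (-((ρZ - yZ - δZ) * Real.log 2) * n)) atTop (𝓝 0) := by
    simpa using (tendsto_exp_neg_mul_nat_erasure (by positivity : 0 < δZ ^ 2 / (4 * yZ))).add
      ((tendsto_exp_neg_mul_nat_erasure (mul_pos hgZ (Real.log_pos (by norm_num)))).const_mul 2)
  have hlimX : Tendsto (fun n : ℕ => Real.exp (-(δX ^ 2 / (4 * yX)) * n) +
      2 * Real.exp (-((ρX - yX - δX) * Real.log 2) * n)) atTop (𝓝 0) := by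
    simpa using (tendsto_exp_neg_mul_nat_erasure (by positivity : 0 < δX ^ 2 / (4 * yX))).add
      ((tendsto_exp_neg_mul_nat_erasure (mul_pos hgX (Real.log_pos (by norm_num)))).const_mul 2)
  refine ⟨HX, G, hc, fun n => ?_, ?_, ?_⟩
  · -- rate
    have hk := CSSCode.k_ge_of_heights (CSSCode.ofMatrices (Matrix.of (HX n)) (Matrix.of (G n)) (hc n))
    have hn : (0 : ℝ) ≤ n := Nat.cast_nonneg _
    have hmZ : (⌊ρZ * (n : ℝ)⌋₊ : ℝ) ≤ ρZ * n := Nat.floor_le (mul_nonneg (by linarith) hn)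
    have hmX : (⌊ρX * (n : ℝ)⌋₊ : ℝ) ≤ ρX * n := Nat.floor_le (mul_nonneg (by linarith) hn)
    have hρn := mul_le_mul_of_nonneg_right hρ hn
    linarith
  · -- `Z`-sector
    refine squeeze_zero (fun n => ErasureDecoder.uncorrectableProb_nonneg _ _ hyZ.le hyZ1) (fun n => ?_) hlimZ
    rw [ErasureDecoder.uncorrectableProb_eq_sum]
    have h1 := hHX n ((CSSCode.ofMatrices (Matrix.of (HX n)) (Matrix.of (G n)) (hc n)).rowSpZ :
      Set (Fin n → ZMod 2)) (Submodule.zero_mem _)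
    exact h1.trans (erasure_finiteSize_le hyZ.le hyZ1 hδZ0 hδZy n)
  · -- `X`-sector
    refine squeeze_zero (fun n => ErasureDecoder.uncorrectableProb_nonneg _ _ hyX.le hyX1) (fun n => ?_) hlimX
    rw [ErasureDecoder.uncorrectableProb_eq_sum]
    exact (hG n).trans (erasure_finiteSize_le hyX.le hyX1 hδX0 hδXy n)

/-- **THRESHOLD FORM**: for `0 < y_Z < ρ_Z`, `0 < y_X < ρ_X`, `0 ≤ R`, `ρ_Z + ρ_X ≤ 1 - R` the CSS family of
`exists_cssFamily_erasure_tendsto_zero` (rate `≥ R`) has its `Z`-sector erasures below threshold at EVERY loss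
rate `0 ≤ y ≤ y_Z` and its `X`-sector erasures at every `0 ≤ y ≤ y_X` (monotonicity in the loss rate), hence
`y_Z ≤ y_c^Z` and `y_X ≤ y_c^X` for the two erasure accuracy thresholds. [cite: BennettDivincenzoSmolin1997,
p. 3218 (recover … all erased qubits with probability tending to 1 in the limit of large block size);
DennisEtAl2002, §4.3 (below threshold) and §4.6 (p_c)] -/
theorem exists_cssFamily_erasure_thresholds_ge {yZ yX ρZ ρX R : ℝ} (hyZ : 0 < yZ) (hZ : yZ < ρZ) (hyX : 0 < yX)
    (hX : yX < ρX) (hR0 : 0 ≤ R) (hρ : ρZ + ρX ≤ 1 - R) :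
    ∃ (HX : ∀ n : ℕ, Fin ⌊ρZ * n⌋₊ → Fin n → ZMod 2) (HZ : ∀ n : ℕ, Fin ⌊ρX * n⌋₊ → Fin n → ZMod 2)
      (hc : ∀ n, Matrix.of (HX n) * (Matrix.of (HZ n))ᵀ = 0),
      (∀ n : ℕ, R * (n : ℝ) ≤ ((CSSCode.ofMatrices (Matrix.of (HX n)) (Matrix.of (HZ n)) (hc n)).k : ℝ)) ∧
      (∀ y, 0 ≤ y → y ≤ yZ → BelowThreshold (fun n y => ErasureDecoder.uncorrectableProb
        {x : Fin n → ZMod 2 | (CSSCode.ofMatrices (Matrix.of (HX n)) (Matrix.of (HZ n)) (hc n)).HX *ᵥ x = 0}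
        ((CSSCode.ofMatrices (Matrix.of (HX n)) (Matrix.of (HZ n)) (hc n)).rowSpZ : Set (Fin n → ZMod 2)) y) y) ∧
      (∀ y, 0 ≤ y → y ≤ yX → BelowThreshold (fun n y => ErasureDecoder.uncorrectableProb
        {x : Fin n → ZMod 2 | (CSSCode.ofMatrices (Matrix.of (HX n)) (Matrix.of (HZ n)) (hc n)).HZ *ᵥ x = 0}
        ((CSSCode.ofMatrices (Matrix.of (HX n)) (Matrix.of (HZ n)) (hc n)).rowSpX : Set (Fin n → ZMod 2)) y) y) ∧
      yZ ≤ accuracyThreshold (fun n y => ErasureDecoder.uncorrectableProb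
        {x : Fin n → ZMod 2 | (CSSCode.ofMatrices (Matrix.of (HX n)) (Matrix.of (HZ n)) (hc n)).HX *ᵥ x = 0}
        ((CSSCode.ofMatrices (Matrix.of (HX n)) (Matrix.of (HZ n)) (hc n)).rowSpZ : Set (Fin n → ZMod 2)) y) ∧
      yX ≤ accuracyThreshold (fun n y => ErasureDecoder.uncorrectableProb
        {x : Fin n → ZMod 2 | (CSSCode.ofMatrices (Matrix.of (HX n)) (Matrix.of (HZ n)) (hc n)).HZ *ᵥ x = 0}
        ((CSSCode.ofMatrices (Matrix.of (HX n)) (Matrix.of (HZ n)) (hc n)).rowSpX : Set (Fin n → ZMod 2)) y) := by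
  obtain ⟨HX, HZ, hc, hk, hZt, hXt⟩ := exists_cssFamily_erasure_tendsto_zero hyZ hZ hyX hX hR0 hρ
  have hyZ1 : yZ ≤ 1 := by linarith
  have hyX1 : yX ≤ 1 := by linarith
  have hbZ : ∀ y, 0 ≤ y → y ≤ yZ → BelowThreshold (fun n y => ErasureDecoder.uncorrectableProb
      {x : Fin n → ZMod 2 | (CSSCode.ofMatrices (Matrix.of (HX n)) (Matrix.of (HZ n)) (hc n)).HX *ᵥ x = 0}
      ((CSSCode.ofMatrices (Matrix.of (HX n)) (Matrix.of (HZ n)) (hc n)).rowSpZ : Set (Fin n → ZMod 2)) y) y := by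
    intro y hy0 hy
    unfold BelowThreshold
    exact squeeze_zero (fun n => ErasureDecoder.uncorrectableProb_nonneg _ _ hy0 (hy.trans hyZ1))
      (fun n => uncorrectableProb_mono_rate _ _ hy0 hy hyZ1) hZt
  have hbX : ∀ y, 0 ≤ y → y ≤ yX → BelowThreshold (fun n y => ErasureDecoder.uncorrectableProb
      {x : Fin n → ZMod 2 | (CSSCode.ofMatrices (Matrix.of (HX n)) (Matrix.of (HZ n)) (hc n)).HZ *ᵥ x = 0}
      ((CSSCode.ofMatrices (Matrix.of (HX n)) (Matrix.of (HZ n)) (hc n)).rowSpX : Set (Fin n → ZMod 2)) y) y := by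
    intro y hy0 hy
    unfold BelowThreshold
    exact squeeze_zero (fun n => ErasureDecoder.uncorrectableProb_nonneg _ _ hy0 (hy.trans hyX1))
      (fun n => uncorrectableProb_mono_rate _ _ hy0 hy hyX1) hXt
  refine ⟨HX, HZ, hc, hk, hbZ, hbX, ?_, ?_⟩
  · exact le_accuracyThreshold (fun y hy0 hy => hbZ y hy0 hy.le) hyZ1
  · exact le_accuracyThreshold (fun y hy0 hy => hbX y hy0 hy.le) hyX1

/-- **THE CSS ERASURE CEILING `y₀^Z + y₀^X ≤ 1 - R` IS ATTAINED ALONG THE WHOLE LINE** (Bennett–DiVincenzo–Smolin's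
`Q = 1 - 2ε`, sector-wise: «two bits of redundancy per erased qubit are necessary and sufficient»): for
`0 < y_Z`, `0 < y_X`, `0 ≤ R` and `y_Z + y_X < 1 - R` there are row densities `ρ_Z > y_Z`, `ρ_X > y_X` with
`ρ_Z + ρ_X = 1 - R` and CSS codes `C_n` on `n` qubits (`⌊ρ_Z n⌋` `X`-checks, `⌊ρ_X n⌋` `Z`-checks) with
`k_n ≥ R n` whose `Z`-sector erasure accuracy threshold is `≥ y_Z` AND whose `X`-sector erasure accuracy
threshold is `≥ y_X`. The converse `y_c^Z + y_c^X ≤ 1 - R` for every family with `k ≥ 1` is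
`erasure_accuracyThresholds_add_le_one_sub_rate`. [cite: BennettDivincenzoSmolin1997, p. 3218 (Q = max{0, 1 − 2ε};
two bits of redundancy per erased qubit are necessary and sufficient; footnote cf2); DelfosseZemor2013, §3
(R ≤ 1 − 2p)] -/
theorem exists_cssFamily_erasure_bothSectors {yZ yX R : ℝ} (hyZ : 0 < yZ) (hyX : 0 < yX) (hR0 : 0 ≤ R)
    (h : yZ + yX < 1 - R) :
    ∃ ρZ ρX : ℝ, yZ < ρZ ∧ yX < ρX ∧ ρZ + ρX = 1 - R ∧
      ∃ (HX : ∀ n : ℕ, Fin ⌊ρZ * n⌋₊ → Fin n → ZMod 2) (HZ : ∀ n : ℕ, Fin ⌊ρX * n⌋₊ → Fin n → ZMod 2)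
        (hc : ∀ n, Matrix.of (HX n) * (Matrix.of (HZ n))ᵀ = 0),
        (∀ n : ℕ, R * (n : ℝ) ≤ ((CSSCode.ofMatrices (Matrix.of (HX n)) (Matrix.of (HZ n)) (hc n)).k : ℝ)) ∧
        yZ ≤ accuracyThreshold (fun n y => ErasureDecoder.uncorrectableProb
          {x : Fin n → ZMod 2 | (CSSCode.ofMatrices (Matrix.of (HX n)) (Matrix.of (HZ n)) (hc n)).HX *ᵥ x = 0}
          ((CSSCode.ofMatrices (Matrix.of (HX n)) (Matrix.of (HZ n)) (hc n)).rowSpZ : Set (Fin n → ZMod 2)) y) ∧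
        yX ≤ accuracyThreshold (fun n y => ErasureDecoder.uncorrectableProb
          {x : Fin n → ZMod 2 | (CSSCode.ofMatrices (Matrix.of (HX n)) (Matrix.of (HZ n)) (hc n)).HZ *ᵥ x = 0}
          ((CSSCode.ofMatrices (Matrix.of (HX n)) (Matrix.of (HZ n)) (hc n)).rowSpX : Set (Fin n → ZMod 2)) y) := by
  refine ⟨yZ + (1 - R - yZ - yX) / 2, yX + (1 - R - yZ - yX) / 2, by linarith, by linarith, by ring, ?_⟩
  obtain ⟨HX, HZ, hc, hk, -, -, hZ, hX⟩ := exists_cssFamily_erasure_thresholds_ge (ρZ := yZ + (1 - R - yZ - yX) / 2)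
    (ρX := yX + (1 - R - yZ - yX) / 2) hyZ (by linarith) hyX (by linarith) hR0 (by linarith)
  exact ⟨HX, HZ, hc, hk, hZ, hX⟩

end Families

end Literature.InformationTheory.QuantumCodes
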